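import Literature.Computability.AlgebraicComplexity.BI17ChowPowerSumPolystableProofs
import Literature.Computability.AlgebraicComplexity.BI17QuadraticPolystableProofs
import Literature.AlgebraicGeometry.PlaneCurves.HesseCanonicalForm
import Mathlib.LinearAlgebra.Matrix.MvPolynomial
import HarnessLib

/-!
# Every smooth plane cubic is polystable (towards the `(D, m) = (3, 3)` case of
# Bürgisser–Ikenmeyer 2017, Prop. 2.10)

Sibling proof file of `Literature/Computability/AlgebraicComplexity/BI17FundamentalInvariantForms.lean`
(cell `val-lit`, DAG row BI2017-A), continuing the explicit slices of the named fact
`BI2017_prop_2_10` ("if `D > 1`, almost all `w ∈ Sym^D ℂ^m` are polystable"; `D = 2`, `m ≤ 1`,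
`(3, 2)`, `(4, 2)` are in the tree). Here the ternary cubics:

* `isPolystable_hesse` — every member `X³ + Y³ + Z³ − 3μXYZ` of the Hesse pencil is polystable
  (the case `m = 3` of `isPolystable_fermat_add_chow`, Kempf–Ness route);
* `isPolystable_of_forall_regular_ternaryCubic` — **every SMOOTH ternary cubic form is polystable**
  (its `SL₃`-orbit is Zariski closed): by Artebani–Dolgachev's Lemma 1, PROVED in the tree as
  `Literature.AlgebraicGeometry.PlaneCurves.exists_bind₁_eq_smul_hesse_of_forall_regular` ("any
  smooth plane cubic is projectively equivalent to a member of the Hesse pencil"), a smooth cubic is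
  `M · (c · H_μ)` with `M ∈ GL₃`, `c ≠ 0`, and polystability is a property of `GL`-orbits and of
  non-zero scalar multiples (`IsPolystable.linSubst_of_det_ne_zero`, `IsPolystable.const_smul`).

This is the classical "smooth hypersurfaces are stable" (Mumford) for plane cubics, obtained here
without the Hilbert–Mumford criterion. HONEST PARTIAL with respect to Prop. 2.10 at `(3, 3)`: the
genericity is expressed by the predicate "all points regular", NOT yet as `IsZariskiGeneric 3
IsPolystable` — the missing piece is a non-zero polynomial in the ten coefficients vanishing on all
singular cubics (the discriminant of ternary cubics, degree 12, or the resultant of the three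
partials), which the tree does not have; sized L. Nothing here bears on lower bounds or on `VP`
versus `VNP`.

## References

* [BurgisserIkenmeyer2017] P. Bürgisser, C. Ikenmeyer, J. Algebra 477 (2017) = arXiv:1511.02927,
  Prop. 2.10, Def. 2.7, Cor. 2.9.
* [ArtebaniDolgachev2009] M. Artebani, I. Dolgachev, *The Hesse pencil of plane cubic curves*,
  Enseign. Math. (2) 55 (2009) 235–273, §2 Lemma 1.
-/

noncomputable section

open MvPolynomial Matrix

namespace Literature.Computability.AlgebraicComplexity

/-- The tree's `linSubst A` (`X_i ↦ ∑_j A_{ji} X_j`) is Mathlib's substitution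
`bind₁ (Aᵀ).toMvPolynomial` (private copy, as in `BI17FormPolystabilityCounterexample.lean`).
[folklore] -/
private theorem linSubst_eq_bind₁' {k : Type*} [Field k] {m : ℕ} (A : Matrix (Fin m) (Fin m) k)
    (p : MvPolynomial (Fin m) k) :
    linSubst (Fin m) k A p = bind₁ A.transpose.toMvPolynomial p := by
  have h : linSubst (Fin m) k A = bind₁ A.transpose.toMvPolynomial := by
    apply MvPolynomial.algHom_ext
    intro i
    rw [linSubst_X, bind₁_X_right, Matrix.toMvPolynomial]
    refine Finset.sum_congr rfl fun j _ => ?_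
    rw [Matrix.transpose_apply, smul_eq_C_mul, ← pow_one (X j), C_mul_X_pow_eq_monomial]
  rw [h]

/-- **Every member of the Hesse pencil is polystable**: `X³ + Y³ + Z³ − 3μ XYZ` has Zariski-closed
`SL₃`-orbit for every `μ ∈ ℂ` (smooth members, the four triangles `μ³ = 1`, and `μ = ∞` excluded
only notationally — `XYZ` itself is `isPolystable_prod_X 3`). Case `m = 3` of
`isPolystable_fermat_add_chow`. [cite: BurgisserIkenmeyer2017, Cor. 2.9 (proof) and Prop. 2.8] -/
theorem isPolystable_hesse (μ : ℂ) :
    IsPolystable (X 0 ^ 3 + X 1 ^ 3 + X 2 ^ 3 - C (3 * μ) * (X 0 * X 1 * X 2) : MvPolynomial (Fin 3) ℂ) := by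
  have h := isPolystable_fermat_add_chow (m := 3) le_rfl 1 (-(3 * μ))
  have e : (C 1 * (∑ i : Fin 3, X i ^ 3) + C (-(3 * μ)) * ∏ i : Fin 3, X i : MvPolynomial (Fin 3) ℂ) =
      X 0 ^ 3 + X 1 ^ 3 + X 2 ^ 3 - C (3 * μ) * (X 0 * X 1 * X 2) := by
    simp only [Fin.sum_univ_three, Fin.prod_univ_three, map_one, one_mul, map_neg]
    ring
  rwa [e] at h

/-- **Every smooth ternary cubic form is polystable.** If `F ∈ Sym³ ℂ³` has all its points regular
(`∇F(p) ≠ 0` at every non-zero point `p` of `{F = 0}`), then the `SL₃`-orbit of `F` is Zariski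
closed: `F` is projectively equivalent to `c · H_μ` (Artebani–Dolgachev Lemma 1, tree theorem
`exists_bind₁_eq_smul_hesse_of_forall_regular`), and `H_μ` is polystable (`isPolystable_hesse`).
This is the polystability predicate of BI 2017 Prop. 2.10 at `(D, m) = (3, 3)` on the smooth locus;
the `IsZariskiGeneric` wrapper (a discriminant) is NOT here.
[cite: BurgisserIkenmeyer2017, Prop. 2.10 (case (D, m) = (3, 3), smooth locus; normal form = ArtebaniDolgachev2009 §2 Lemma 1)] -/
theorem isPolystable_of_forall_regular_ternaryCubic {F : MvPolynomial (Fin 3) ℂ}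
    (hF : F.IsHomogeneous 3)
    (hreg : ∀ p : Fin 3 → ℂ, p ≠ 0 → eval p F = 0 → (fun i => eval p (pderiv i F)) ≠ 0) :
    IsPolystable F := by
  obtain ⟨μ, M, c, -, hM, hc, hFM⟩ :=
    Literature.AlgebraicGeometry.PlaneCurves.exists_bind₁_eq_smul_hesse_of_forall_regular
      (K := ℂ) two_ne_zero three_ne_zero hF hreg
  have h' : linSubst (Fin 3) ℂ Mᵀ F =
      c • (X 0 ^ 3 + X 1 ^ 3 + X 2 ^ 3 - C (3 * μ) * (X 0 * X 1 * X 2) : MvPolynomial (Fin 3) ℂ) := by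
    rw [linSubst_eq_bind₁', Matrix.transpose_transpose]
    exact hFM
  have hps : IsPolystable
      (c • (X 0 ^ 3 + X 1 ^ 3 + X 2 ^ 3 - C (3 * μ) * (X 0 * X 1 * X 2)) : MvPolynomial (Fin 3) ℂ) :=
    (isPolystable_hesse μ).const_smul hc
  have hMt : Mᵀ.det ≠ 0 := by rwa [Matrix.det_transpose]
  have hinv : (Mᵀ)⁻¹ * Mᵀ = 1 := Matrix.nonsing_inv_mul _ (isUnit_iff_ne_zero.mpr hMt)
  have hFeq : F = linSubst (Fin 3) ℂ (Mᵀ)⁻¹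
      (c • (X 0 ^ 3 + X 1 ^ 3 + X 2 ^ 3 - C (3 * μ) * (X 0 * X 1 * X 2)) : MvPolynomial (Fin 3) ℂ) := by
    rw [← h', ← AlgHom.comp_apply, ← linSubst_mul, hinv, linSubst_one, AlgHom.id_apply]
  rw [hFeq]
  refine hps.linSubst_of_det_ne_zero ?_
  rw [Matrix.det_nonsing_inv, Ring.inverse_eq_inv']
  exact inv_ne_zero hMt

end Literature.Computability.AlgebraicComplexity

end
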